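import Literature.Probability.Percolation.DecisionTreeBK
import Mathlib.Algebra.Order.BigOperators.Ring.Finset
import Mathlib.Data.Fintype.BigOperators
import Mathlib.Data.Fintype.Pi
import Mathlib.Data.Fintype.Prod
import Mathlib.Logic.Function.Basic
import Mathlib.Order.UpperLower.Basic
import Mathlib.Tactic.Linarith
import Mathlib.Tactic.NormNum
import Mathlib.Tactic.Positivity
import Mathlib.Tactic.Ring
import HarnessLib

/-!
# Generating decision trees and Gladkov's Main Lemma 8.1; the decision-tree Richards inequality
# (Gladkov 2024, §8: Main Lemma 8.1, Theorem 8.7, Remark 8.8)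

Topic `Literature/Probability/Percolation`. Source: N. Gladkov, *Percolation Inequalities and Decision
Trees*, arXiv:2408.08457v2 (2024) [Gladkov2024], §8 "General form of decision tree inequalities"
(pp. 13–17).  The setup (p. 13, verbatim): "the decision tree generates a configuration as it goes rather
than reveals what was hidden. Assume that at each node `N` of the decision tree `T`, it chooses an edge
`e(N)` of the graph and makes a decision `D(N) ∈ {1, 2}`, and then generates a random element of one of
two probability spaces `Ω₁(e)` or `Ω₂(e)` according to the measures `μ₁(e)` or `μ₂(e)` respectively. …
Assume that event `A ⊆ Ω` is such that for every edge `e` and every configuration `C ∈ Ω` the probability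
of `A` is bigger if `e` is resampled from `μ₂(e)` rather than if it is resampled from `μ₁(e)`."

**Main Lemma 8.1** (p. 13): "Let `T` be a decision tree in the setup above building configuration `C`.
Let `A` be an event in `Ω`. Let `e` be an arbitrary edge and `C ∈ Ω` an arbitrary configuration. Denote
by `X₁ = X₁(C, e)` the subset of such `x ∈ Ω₁` and by `X₂ = X₂(C, e)` the subset of such `x ∈ Ω₂` that
`C →_{E∖{e}} x ∈ A`. Assume that for every `e` and `C` one has `μ₁(X₁) ≤ μ₂(X₂)` (18). Then
`P(C₁ ∈ A) ≤ P(C ∈ A) ≤ P(C₂ ∈ A)` (19)", where `C₁`, `C₂` are the configurations all of whose edges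
are generated from `μ₁`, resp. `μ₂` (the product laws).  This is the paper's "main technical result"
(p. 2); Theorems 3.2 (decision-tree Harris–Kleitman), 4.3 (decision-tree vdBK), 8.2, 8.4, 8.6 and 8.7 are
its instances (p. 14).  It was listed as NOT formalised in `DecisionTreeBK.lean`,
`DecisionTreeWeighted.lean`, `DecisionTreeTwoConfig.lean`; this file supplies it, together with

**Theorem 8.7** (p. 16, the decision-tree RICHARDS inequality), in the WEIGHTED form the proof supports
(each edge `e` with its own probability `p e ∈ [0, 1]`; the paper prints `p = 1/2`): with
`Ω₁ = Ω₂ = {0,1}³`, `μ₁ = ⅔·(law of three equal `p`-coins) + ⅓·(three independent `p`-coins)` and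
`μ₂ = ⅓·Σ_{i} (coin `i` independent, the other two equal)`, "Let `C₁`, `C` and `C₂` be the configurations
built by decision trees as above. Then `P(C₁ ∈ U×V×W) ≥ P(C ∈ U×V×W) ≥ P(C₂ ∈ U×V×W)` (24)" for
increasing `U, V, W`.  Remark 8.8 (p. 17): "This final application of Main Lemma 8.1 stems from the work
of Richards [R04]. His paper provides an incorrect proof for the inequality
`2P(U∩V∩W) + P(U)P(V)P(W) ≥ P(U)P(V∩W) + P(V)P(U∩W) + P(W)P(V∩U)` (25) … The induction step implicitly
worked in the space of triples of configurations and effectively was equivalent to equation (24).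
Inequality (25) is still a conjecture. Sahi [S08] generalized this inequality to a series of conjectured
inequalities."  So (24) is the one THEOREM-grade cubic inequality of the Richards / Sahi-`E₃` shape in
print (cf. `Literature.Probability.LatticeModels.SahiThirdOrderCorrelation` for `E₃` itself).

## Design (finitary weighted calculus, no measure theory — as in the sibling `DecisionTree*` files)

* Edges `ι` and outcomes `Ω` are finite types; a configuration is a function `C : ι → Ω`; the two
  "measures" are weight functions `μ₁ μ₂ : ι → Ω → ℝ` (nonnegativity is assumed where needed; total mass
  one is never needed for the Main Lemma; a smaller outcome space `Ω₁(e) ⊊ Ω₂(e)` is modelled by zero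
  weights).
* `condEx μ D f C` — the expectation of `f` when the coordinates in `D` are drawn independently from
  `μ` and the others are frozen at `C` (a finite sum over all `C' : ι → Ω` with an indicator); at `D = ∅`
  it is `f C`, at `D = univ` it is the product-law expectation `Ex μ f`; `condEx_insert` is the
  one-coordinate disintegration.
* `ResampleLE μ₁ μ₂ f` — condition (18) in functional form: for every `C` and `e`,
  `Σ_x μ₁ e x · f (C[e ↦ x]) ≤ Σ_x μ₂ e x · f (C[e ↦ x])`; for `f = 𝟙_A` this is literally
  `μ₁(X₁(C,e)) ≤ μ₂(X₂(C,e))`.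
* `GTree ι Ω` — a generating tree: a leaf, or a node `(e, d, ch)` querying `e` with decision `d`
  (`false` = `μ₁`, `true` = `μ₂`) and one child `ch x` per outcome `x`.  `GTree.eval μ₁ μ₂ T D f C` runs
  `T` on the live coordinates `D` from the frozen values `C` and, at a leaf, draws the coordinates not
  generated so far from `μ₁`; `GTree.ValidOn T D` says that every node queries a live coordinate and no
  descendant re-queries it ("each path from `N₀` to a leaf node contains all edges once": a path that
  stops early is completed with `μ₁`-draws, which changes nothing for a tree that queries every edge).
* **`GTree.condEx_le_eval` / `GTree.eval_le_condEx`** — Main Lemma 8.1: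
  `condEx μ₁ D f C ≤ eval T D f C ≤ condEx μ₂ D f C` for `T` valid on `D`; at `D = univ`
  (`GTree.ex_le_eval`, `GTree.eval_le_ex`): `Ex μ₁ f ≤ P_T(f) ≤ Ex μ₂ f`, i.e. (19).  The proof is the
  printed one re-organised as a structural induction: the averaged form of (18)
  (`sum_mul_condEx_update_le`, induction on the frozen set) is exactly the step "replace the lowest
  `μ₂`-node by a `μ₁`-node", and `condEx_le_condEx` (the tree-free hybrid `Ex μ₁ f ≤ Ex μ₂ f`) is the
  case of the complete tree.
* `secAt A C e` (the section `X(C,e) = {x | C[e ↦ x] ∈ A}`) and `resampleLE_ind_iff` — for an event,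
  `ResampleLE μ₁ μ₂ 𝟙_A ↔ ∀ C e, μ₁ e (X(C,e)) ≤ μ₂ e (X(C,e))`, the printed (18) verbatim
  (one outcome space `Ω ⊇ Ω₁(e) ∪ Ω₂(e)`, so `X₁ = X ∩ Ω₁` is accounted for by the zero weights).
* **Theorem 8.7**: `Richards.μ₁`, `Richards.μ₂` (the two three-coin couplings, weighted; `sum_μ₁`,
  `sum_μ₂`: total mass one), `Richards.tripleEvent U V W`, `Richards.resampleLE_inc` / `_dec` (condition
  (18), reversed, for three up-sets / three down-sets — the printed five-case check `caseCheck_inc/_dec`,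
  i.e. the inequality `a·min(b,c) + b·min(a,c) + c·min(a,b) ≤ 2·min(a,b,c) + abc` on `{0, p_e, 1}³`),
  **`Richards.thm87_inc` / `Richards.thm87_dec`** ((24): `P(C₂ ∈ U×V×W) ≤ P(C_T ∈ U×V×W) ≤ P(C₁ ∈ U×V×W)`)
  and the tree-free corollaries **`Richards.ex₂_le_ex₁_inc` / `_dec`** `P(C₂ ∈ U×V×W) ≤ P(C₁ ∈ U×V×W)`.
  `ex_const` — `Ex μ c = c` for weights of total mass one (so these are probabilities).

Not here: Theorems 8.2/8.4 (`A ⋈ B`), 8.6 (coloured percolation, a `p = 1/2` statement), the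
re-derivation of Thms 3.2/4.3 from the Main Lemma (they are in `DecisionTreeWeighted.lean` directly), and
any bridge to `prodBernoulli` on `Set (Sym2 V)` (pattern: `GladkovThreePointBoundProofs.real_eq_Pr`).

## References
* N. Gladkov, *Percolation Inequalities and Decision Trees*, arXiv:2408.08457v2 (2024), §8, Main Lemma 8.1,
  Theorem 8.7, Remark 8.8. [Gladkov2024]
* S. Sahi, *Higher correlation inequalities*, Combinatorica 28 (2008) 209–227. [Sahi2008]
-/

noncomputable section

open Classical

namespace Literature.Probability.Percolation

namespace DecisionTree

open Finset Function

variable {ι : Type*} [Fintype ι] [DecidableEq ι] {Ω : Type*} [Fintype Ω] [DecidableEq Ω]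

/-! ### Conditional expectations with frozen coordinates -/
section CondExp

/-- `condEx μ D f C`: the expectation of `f` when the coordinates in `D` are drawn independently with
weights `μ i` and the coordinates outside `D` are frozen at their values in `C`:
`Σ_{C'} 1[C' = C off D] · (∏_{i ∈ D} μ i (C' i)) · f C'`. [cite: Gladkov2024, §8 (setup, p. 13)] -/
def condEx (μ : ι → Ω → ℝ) (D : Finset ι) (f : (ι → Ω) → ℝ) (C : ι → Ω) : ℝ :=
  ∑ C' : ι → Ω, if (∀ i, i ∉ D → C' i = C i) then (∏ i ∈ D, μ i (C' i)) * f C' else 0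

/-- The product-law expectation `Ex μ f = Σ_{C} (∏_i μ i (C i)) · f C` ("`P(C₁ ∈ A)`" for `f = 𝟙_A`,
`μ = μ₁`). [cite: Gladkov2024, §8 (19)] -/
def Ex (μ : ι → Ω → ℝ) (f : (ι → Ω) → ℝ) : ℝ :=
  ∑ C : ι → Ω, (∏ i, μ i (C i)) * f C

/-- With nothing left to draw, `condEx μ ∅ f C = f C`. [folklore] -/
theorem condEx_empty (μ : ι → Ω → ℝ) (f : (ι → Ω) → ℝ) (C : ι → Ω) :
    condEx μ ∅ f C = f C := by
  unfold condEx
  have key : ∀ C' : ι → Ω, (∀ i, i ∉ (∅ : Finset ι) → C' i = C i) ↔ C' = C := by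
    intro C'
    constructor
    · intro h; funext i; exact h i (by simp)
    · rintro rfl i _; rfl
  simp_rw [key, prod_empty, one_mul]
  rw [Finset.sum_ite_eq' univ C f]
  simp

/-- With everything left to draw, `condEx μ univ f C = Ex μ f` (independent of `C`). [folklore] -/
theorem condEx_univ (μ : ι → Ω → ℝ) (f : (ι → Ω) → ℝ) (C : ι → Ω) :
    condEx μ univ f C = Ex μ f := by
  unfold condEx Ex
  refine sum_congr rfl fun C' _ => ?_
  rw [if_pos (fun i hi => absurd (mem_univ i) hi)]

/-- **One-coordinate disintegration**: for `e ∉ D`,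
`condEx μ (insert e D) f C = Σ_x μ e x · condEx μ D f (C[e ↦ x])`. [folklore] -/
theorem condEx_insert (μ : ι → Ω → ℝ) {e : ι} {D : Finset ι} (he : e ∉ D) (f : (ι → Ω) → ℝ)
    (C : ι → Ω) :
    condEx μ (insert e D) f C = ∑ x, μ e x * condEx μ D f (update C e x) := by
  unfold condEx
  simp_rw [mul_sum]
  rw [sum_comm]
  refine sum_congr rfl fun C' _ => ?_
  -- the agreement condition off `D` with `C[e ↦ x]` is `C' e = x` plus agreement off `insert e D` with `C`
  have hiff : ∀ x : Ω, (∀ i, i ∉ D → C' i = update C e x i) ↔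
      (C' e = x ∧ ∀ i, i ∉ insert e D → C' i = C i) := by
    intro x
    constructor
    · intro h
      refine ⟨by simpa using h e he, fun i hi => ?_⟩
      rw [mem_insert, not_or] at hi
      simpa [update_of_ne hi.1] using h i hi.2
    · rintro ⟨hx, h⟩ i hi
      by_cases hie : i = e
      · subst hie; simpa using hx
      · rw [update_of_ne hie]
        exact h i (by simp [hie, hi])
  by_cases hC : ∀ i, i ∉ insert e D → C' i = C i
  · rw [if_pos hC, prod_insert he]
    have key : ∀ x : Ω,
        μ e x * (if (∀ i, i ∉ D → C' i = update C e x i) then (∏ i ∈ D, μ i (C' i)) * f C' else 0) =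
          if C' e = x then μ e (C' e) * ((∏ i ∈ D, μ i (C' i)) * f C') else 0 := by
      intro x
      by_cases hx : C' e = x
      · rw [if_pos ((hiff x).2 ⟨hx, hC⟩), if_pos hx, ← hx]
      · rw [if_neg (fun h => hx ((hiff x).1 h).1), if_neg hx, mul_zero]
    rw [sum_congr rfl fun x _ => key x, Finset.sum_ite_eq univ (C' e)]
    simp [mul_assoc]
  · rw [if_neg hC]
    refine (Finset.sum_eq_zero fun x _ => ?_).symm
    rw [if_neg (fun h => hC ((hiff x).1 h).2), mul_zero]

/-- `condEx` is monotone in the integrand for nonnegative weights. [folklore] -/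
theorem condEx_mono {μ : ι → Ω → ℝ} (hμ : ∀ i x, 0 ≤ μ i x) (D : Finset ι) {f g : (ι → Ω) → ℝ}
    (hfg : ∀ C, f C ≤ g C) (C : ι → Ω) : condEx μ D f C ≤ condEx μ D g C := by
  unfold condEx
  refine sum_le_sum fun C' _ => ?_
  by_cases h : ∀ i, i ∉ D → C' i = C i
  · rw [if_pos h, if_pos h]
    exact mul_le_mul_of_nonneg_left (hfg C') (prod_nonneg fun i _ => hμ i (C' i))
  · rw [if_neg h, if_neg h]

/-- `condEx` of a nonnegative function is nonnegative for nonnegative weights. [folklore] -/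
theorem condEx_nonneg {μ : ι → Ω → ℝ} (hμ : ∀ i x, 0 ≤ μ i x) (D : Finset ι) {f : (ι → Ω) → ℝ}
    (hf : ∀ C, 0 ≤ f C) (C : ι → Ω) : 0 ≤ condEx μ D f C := by
  unfold condEx
  refine sum_nonneg fun C' _ => ?_
  by_cases h : ∀ i, i ∉ D → C' i = C i
  · rw [if_pos h]; exact mul_nonneg (prod_nonneg fun i _ => hμ i (C' i)) (hf C')
  · rw [if_neg h]

end CondExp

/-! ### Condition (18) and the hybrid step -/
section Hybrid

/-- Gladkov's condition (18) in functional form: resampling any one coordinate of any configuration from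
`μ₂` rather than from `μ₁` does not decrease the (conditional) expectation of `f`:
`Σ_x μ₁ e x · f (C[e ↦ x]) ≤ Σ_x μ₂ e x · f (C[e ↦ x])` for all `C`, `e`.  For `f = 𝟙_A` this reads
`μ₁(X₁(C,e)) ≤ μ₂(X₂(C,e))`. [cite: Gladkov2024, Main Lemma 8.1 (18)] -/
def ResampleLE (μ₁ μ₂ : ι → Ω → ℝ) (f : (ι → Ω) → ℝ) : Prop :=
  ∀ (C : ι → Ω) (e : ι), ∑ x, μ₁ e x * f (update C e x) ≤ ∑ x, μ₂ e x * f (update C e x)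

/-- The section of the event `A` at `(C, e)`: "the subset of such `x ∈ Ω` that `C →_{E∖{e}} x ∈ A`",
i.e. `X(C, e) = {x | C[e ↦ x] ∈ A}`. [cite: Gladkov2024, Main Lemma 8.1 (statement)] -/
def secAt (A : Set (ι → Ω)) (C : ι → Ω) (e : ι) : Finset Ω :=
  univ.filter fun x => update C e x ∈ A

omit [Fintype ι] [DecidableEq Ω] in
/-- `Σ_x μ e x · 𝟙_A(C[e ↦ x]) = μ e (X(C,e))`. [folklore] -/
theorem sum_mul_ind_update (μ : ι → Ω → ℝ) (A : Set (ι → Ω)) (C : ι → Ω) (e : ι) :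
    ∑ x, μ e x * ind A (update C e x) = ∑ x ∈ secAt A C e, μ e x := by
  rw [secAt, sum_filter]
  refine sum_congr rfl fun x _ => ?_
  by_cases hx : update C e x ∈ A
  · rw [ind_of_mem hx, mul_one, if_pos hx]
  · rw [ind_of_not_mem hx, mul_zero, if_neg hx]

omit [Fintype ι] [DecidableEq Ω] in
/-- **Condition (18) verbatim for an event**: `ResampleLE μ₁ μ₂ 𝟙_A` says `μ₁ e (X(C,e)) ≤ μ₂ e (X(C,e))`
for all `C`, `e`. [cite: Gladkov2024, Main Lemma 8.1 (18)] -/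
theorem resampleLE_ind_iff (μ₁ μ₂ : ι → Ω → ℝ) (A : Set (ι → Ω)) :
    ResampleLE μ₁ μ₂ (ind A) ↔
      ∀ (C : ι → Ω) (e : ι), ∑ x ∈ secAt A C e, μ₁ e x ≤ ∑ x ∈ secAt A C e, μ₂ e x := by
  unfold ResampleLE
  simp_rw [sum_mul_ind_update]

omit [DecidableEq Ω] in
/-- For weights of total mass one, `Ex μ c = c`: `Ex μ` is the expectation of a probability law.
[folklore] -/
theorem ex_const {μ : ι → Ω → ℝ} (hμ : ∀ i, ∑ x, μ i x = 1) (c : ℝ) : Ex μ (fun _ => c) = c := by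
  unfold Ex
  rw [← sum_mul, ← Fintype.prod_sum]
  simp [hμ]

variable {μ₁ μ₂ : ι → Ω → ℝ} {f : (ι → Ω) → ℝ}

/-- **The hybrid step** (condition (18) averaged over further independent coordinates): for `e ∉ D` and
any nonnegative inner weights `ν`,
`Σ_x μ₁ e x · condEx ν D f (C[e ↦ x]) ≤ Σ_x μ₂ e x · condEx ν D f (C[e ↦ x])`.
This is the inequality `P(C(T′) ∈ A) ≤ P(C(T) ∈ A)` of the printed proof for the lowest `μ₂`-node.
[cite: Gladkov2024, Main Lemma 8.1 (proof, pp. 13–14)] -/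
theorem sum_mul_condEx_update_le (hf : ResampleLE μ₁ μ₂ f) {ν : ι → Ω → ℝ} (hν : ∀ i x, 0 ≤ ν i x)
    (D : Finset ι) :
    ∀ (C : ι → Ω) {e : ι}, e ∉ D →
      ∑ x, μ₁ e x * condEx ν D f (update C e x) ≤ ∑ x, μ₂ e x * condEx ν D f (update C e x) := by
  induction D using Finset.induction_on with
  | empty =>
      intro C e _
      simp_rw [condEx_empty]
      exact hf C e
  | @insert i D hi ih =>
      intro C e he
      rw [mem_insert, not_or] at he
      have key : ∀ μ : ι → Ω → ℝ,
          ∑ x, μ e x * condEx ν (insert i D) f (update C e x) =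
            ∑ y, ν i y * ∑ x, μ e x * condEx ν D f (update (update C i y) e x) := by
        intro μ
        simp_rw [condEx_insert ν hi, mul_sum]
        rw [sum_comm]
        refine sum_congr rfl fun y _ => sum_congr rfl fun x _ => ?_
        rw [update_comm he.1]
        ring
      rw [key μ₁, key μ₂]
      exact sum_le_sum fun y _ => mul_le_mul_of_nonneg_left (ih _ he.2) (hν i y)

/-- **The tree-free hybrid** (`= (19)` for the complete tree): under (18) and nonnegative weights,
`condEx μ₁ D f C ≤ condEx μ₂ D f C`; at `D = univ`, `Ex μ₁ f ≤ Ex μ₂ f` (`ex_le_ex`).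
[cite: Gladkov2024, Main Lemma 8.1 (19)] -/
theorem condEx_le_condEx (hf : ResampleLE μ₁ μ₂ f) (h₁ : ∀ i x, 0 ≤ μ₁ i x) (h₂ : ∀ i x, 0 ≤ μ₂ i x)
    (D : Finset ι) : ∀ C : ι → Ω, condEx μ₁ D f C ≤ condEx μ₂ D f C := by
  induction D using Finset.induction_on with
  | empty => intro C; simp [condEx_empty]
  | @insert e D he ih =>
      intro C
      rw [condEx_insert μ₁ he, condEx_insert μ₂ he]
      calc ∑ x, μ₁ e x * condEx μ₁ D f (update C e x)
          ≤ ∑ x, μ₁ e x * condEx μ₂ D f (update C e x) :=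
            sum_le_sum fun x _ => mul_le_mul_of_nonneg_left (ih _) (h₁ e x)
        _ ≤ ∑ x, μ₂ e x * condEx μ₂ D f (update C e x) :=
            sum_mul_condEx_update_le hf h₂ D C he

/-- `Ex μ₁ f ≤ Ex μ₂ f` under (18): "`P(C₁ ∈ A) ≤ P(C₂ ∈ A)`". [cite: Gladkov2024, Main Lemma 8.1 (19)] -/
theorem ex_le_ex (hf : ResampleLE μ₁ μ₂ f) (h₁ : ∀ i x, 0 ≤ μ₁ i x) (h₂ : ∀ i x, 0 ≤ μ₂ i x) :
    Ex μ₁ f ≤ Ex μ₂ f := by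
  rcases isEmpty_or_nonempty (ι → Ω) with h | ⟨⟨C⟩⟩
  · simp [Ex]
  · rw [← condEx_univ μ₁ f C, ← condEx_univ μ₂ f C]
    exact condEx_le_condEx hf h₁ h₂ univ C

end Hybrid

/-! ### Generating decision trees and Main Lemma 8.1 -/
section Tree

/-- A GENERATING decision tree over edges `ι` with outcomes `Ω`: a leaf, or a node that queries the edge
`e` with decision `d` (`false`: generate `C e` from `μ₁ e`; `true`: from `μ₂ e`) and continues with the
child `ch x` indexed by the generated outcome `x`. [cite: Gladkov2024, §8 (setup, p. 13)] -/
inductive GTree (ι Ω : Type*) : Type _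
  | leaf : GTree ι Ω
  | node (e : ι) (d : Bool) (ch : Ω → GTree ι Ω) : GTree ι Ω

namespace GTree

/-- Running a generating tree: `eval μ₁ μ₂ T D f C` is the expectation of `f` of the configuration built by
`T` when the coordinates in `D` are still to be generated and the others are frozen at `C`; a node
`(e, d, ch)` draws `x` with weights `μ_d e`, sets `C e := x` and continues with `ch x` on `D ∖ {e}`; at a
leaf the coordinates not generated so far are drawn from `μ₁`.  [cite: Gladkov2024, §8 (setup, p. 13)] -/
def eval (μ₁ μ₂ : ι → Ω → ℝ) : GTree ι Ω → Finset ι → ((ι → Ω) → ℝ) → (ι → Ω) → ℝ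
  | leaf, D, f, C => condEx μ₁ D f C
  | node e d ch, D, f, C =>
      ∑ x, (if d then μ₂ else μ₁) e x * eval μ₁ μ₂ (ch x) (D.erase e) f (update C e x)

/-- Validity on the live coordinates `D`: every node queries a live coordinate and its children are valid
on the remaining ones ("the nodes on every path … query pairwise distinct edges").
[cite: Gladkov2024, §8 (setup, p. 13) and Def. 2.4] -/
def ValidOn : GTree ι Ω → Finset ι → Prop
  | leaf, _ => True
  | node e _ ch, D => e ∈ D ∧ ∀ x, ValidOn (ch x) (D.erase e)

variable {μ₁ μ₂ : ι → Ω → ℝ} {f : (ι → Ω) → ℝ}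

/-- At a leaf the remaining coordinates are drawn from `μ₁`. [cite: Gladkov2024, §8 (setup, p. 13)] -/
@[simp] theorem eval_leaf (D : Finset ι) (C : ι → Ω) :
    eval μ₁ μ₂ leaf D f C = condEx μ₁ D f C := rfl

/-- At a node the queried coordinate is drawn with the node's decision and the child continues.
[cite: Gladkov2024, §8 (setup, p. 13)] -/
@[simp] theorem eval_node (e : ι) (d : Bool) (ch : Ω → GTree ι Ω) (D : Finset ι) (C : ι → Ω) :
    eval μ₁ μ₂ (node e d ch) D f C =
      ∑ x, (if d then μ₂ else μ₁) e x * eval μ₁ μ₂ (ch x) (D.erase e) f (update C e x) := rfl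

omit [Fintype ι] [Fintype Ω] [DecidableEq Ω] in
/-- A leaf is valid on anything. [folklore] -/
@[simp] theorem validOn_leaf (D : Finset ι) : ValidOn (leaf : GTree ι Ω) D := trivial

omit [Fintype ι] [Fintype Ω] [DecidableEq Ω] in
/-- Validity of a node, unfolded. [folklore] -/
theorem validOn_node {e : ι} {d : Bool} {ch : Ω → GTree ι Ω} {D : Finset ι} :
    ValidOn (node e d ch) D ↔ e ∈ D ∧ ∀ x, ValidOn (ch x) (D.erase e) := Iff.rfl

/-- **Main Lemma 8.1, lower half**: `P(C₁ ∈ A) ≤ P(C ∈ A)` — for a tree valid on `D`,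
`condEx μ₁ D f C ≤ eval T D f C`, under (18) and nonnegative weights.
[cite: Gladkov2024, Main Lemma 8.1 (19)] -/
theorem condEx_le_eval (hf : ResampleLE μ₁ μ₂ f) (h₁ : ∀ i x, 0 ≤ μ₁ i x) (h₂ : ∀ i x, 0 ≤ μ₂ i x) :
    ∀ (T : GTree ι Ω) (D : Finset ι) (C : ι → Ω), T.ValidOn D →
      condEx μ₁ D f C ≤ T.eval μ₁ μ₂ D f C := by
  intro T
  induction T with
  | leaf => intro D C _; exact le_rfl
  | node e d ch ih =>
      intro D C hV
      obtain ⟨he, hch⟩ := hV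
      rw [eval_node]
      have heD : e ∉ D.erase e := notMem_erase e D
      have hins : insert e (D.erase e) = D := insert_erase he
      -- children: `condEx μ₁ (D ∖ e) f (C[e ↦ x]) ≤ eval (ch x) …`
      have hchild : ∑ x, (if d then μ₂ else μ₁) e x * condEx μ₁ (D.erase e) f (update C e x) ≤
          ∑ x, (if d then μ₂ else μ₁) e x * eval μ₁ μ₂ (ch x) (D.erase e) f (update C e x) :=
        sum_le_sum fun x _ => mul_le_mul_of_nonneg_left (ih x (D.erase e) (update C e x) (hch x))
          (by cases d <;> simp [h₁ e x, h₂ e x])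
      refine le_trans ?_ hchild
      cases d
      · -- a `μ₁`-node: the disintegration identity
        simp only [Bool.false_eq_true, if_false]
        rw [← condEx_insert μ₁ heD, hins]
      · -- a `μ₂`-node: the hybrid step
        simp only [if_true]
        calc condEx μ₁ D f C = ∑ x, μ₁ e x * condEx μ₁ (D.erase e) f (update C e x) := by
              rw [← condEx_insert μ₁ heD, hins]
          _ ≤ ∑ x, μ₂ e x * condEx μ₁ (D.erase e) f (update C e x) :=
              sum_mul_condEx_update_le hf h₁ (D.erase e) C heD

/-- **Main Lemma 8.1, upper half**: `P(C ∈ A) ≤ P(C₂ ∈ A)` — for a tree valid on `D`,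
`eval T D f C ≤ condEx μ₂ D f C`, under (18) and nonnegative weights.
[cite: Gladkov2024, Main Lemma 8.1 (19)] -/
theorem eval_le_condEx (hf : ResampleLE μ₁ μ₂ f) (h₁ : ∀ i x, 0 ≤ μ₁ i x) (h₂ : ∀ i x, 0 ≤ μ₂ i x) :
    ∀ (T : GTree ι Ω) (D : Finset ι) (C : ι → Ω), T.ValidOn D →
      T.eval μ₁ μ₂ D f C ≤ condEx μ₂ D f C := by
  intro T
  induction T with
  | leaf => intro D C _; exact condEx_le_condEx hf h₁ h₂ D C
  | node e d ch ih =>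
      intro D C hV
      obtain ⟨he, hch⟩ := hV
      rw [eval_node]
      have heD : e ∉ D.erase e := notMem_erase e D
      have hins : insert e (D.erase e) = D := insert_erase he
      have hchild : ∑ x, (if d then μ₂ else μ₁) e x * eval μ₁ μ₂ (ch x) (D.erase e) f (update C e x) ≤
          ∑ x, (if d then μ₂ else μ₁) e x * condEx μ₂ (D.erase e) f (update C e x) :=
        sum_le_sum fun x _ => mul_le_mul_of_nonneg_left (ih x (D.erase e) (update C e x) (hch x))
          (by cases d <;> simp [h₁ e x, h₂ e x])
      refine le_trans hchild ?_
      cases d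
      · -- a `μ₁`-node: the hybrid step
        simp only [Bool.false_eq_true, if_false]
        calc ∑ x, μ₁ e x * condEx μ₂ (D.erase e) f (update C e x)
            ≤ ∑ x, μ₂ e x * condEx μ₂ (D.erase e) f (update C e x) :=
              sum_mul_condEx_update_le hf h₂ (D.erase e) C heD
          _ = condEx μ₂ D f C := by rw [← condEx_insert μ₂ heD, hins]
      · -- a `μ₂`-node: the disintegration identity
        simp only [if_true]
        rw [← condEx_insert μ₂ heD, hins]

/-- **Main Lemma 8.1, (19), at the root**: for a tree valid on all coordinates,
`Ex μ₁ f ≤ P_T(f) = eval T univ f C` ("`P(C₁ ∈ A) ≤ P(C ∈ A)`"; the value does not depend on `C`).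
[cite: Gladkov2024, Main Lemma 8.1 (19)] -/
theorem ex_le_eval (hf : ResampleLE μ₁ μ₂ f) (h₁ : ∀ i x, 0 ≤ μ₁ i x) (h₂ : ∀ i x, 0 ≤ μ₂ i x)
    {T : GTree ι Ω} (hT : T.ValidOn univ) (C : ι → Ω) :
    Ex μ₁ f ≤ T.eval μ₁ μ₂ univ f C := by
  rw [← condEx_univ μ₁ f C]
  exact condEx_le_eval hf h₁ h₂ T univ C hT

/-- **Main Lemma 8.1, (19), at the root**: `P_T(f) ≤ Ex μ₂ f` ("`P(C ∈ A) ≤ P(C₂ ∈ A)`").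
[cite: Gladkov2024, Main Lemma 8.1 (19)] -/
theorem eval_le_ex (hf : ResampleLE μ₁ μ₂ f) (h₁ : ∀ i x, 0 ≤ μ₁ i x) (h₂ : ∀ i x, 0 ≤ μ₂ i x)
    {T : GTree ι Ω} (hT : T.ValidOn univ) (C : ι → Ω) :
    T.eval μ₁ μ₂ univ f C ≤ Ex μ₂ f := by
  rw [← condEx_univ μ₂ f C]
  exact eval_le_condEx hf h₁ h₂ T univ C hT

/-! #### The reversed condition: linearity in `f` -/

/-- `condEx` is odd in the integrand. [folklore] -/
theorem _root_.Literature.Probability.Percolation.DecisionTree.condEx_neg (μ : ι → Ω → ℝ)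
    (D : Finset ι) (f : (ι → Ω) → ℝ) (C : ι → Ω) :
    condEx μ D (fun C' => -f C') C = -condEx μ D f C := by
  unfold condEx
  rw [← sum_neg_distrib]
  refine sum_congr rfl fun C' _ => ?_
  split_ifs <;> ring

/-- `eval` is odd in the integrand. [folklore] -/
theorem eval_neg (μ₁ μ₂ : ι → Ω → ℝ) :
    ∀ (T : GTree ι Ω) (D : Finset ι) (f : (ι → Ω) → ℝ) (C : ι → Ω),
      T.eval μ₁ μ₂ D (fun C' => -f C') C = -T.eval μ₁ μ₂ D f C := by
  intro T
  induction T with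
  | leaf => intro D f C; exact condEx_neg μ₁ D f C
  | node e d ch ih =>
      intro D f C
      rw [eval_node, eval_node, ← sum_neg_distrib]
      refine sum_congr rfl fun x _ => ?_
      rw [ih x]
      ring

omit [Fintype ι] [DecidableEq Ω] in
/-- Condition (18) for `-f` is condition (18) for `f` with the two weights exchanged. [folklore] -/
theorem _root_.Literature.Probability.Percolation.DecisionTree.resampleLE_neg_iff
    {μ₁ μ₂ : ι → Ω → ℝ} {f : (ι → Ω) → ℝ} :
    ResampleLE μ₁ μ₂ (fun C' => -f C') ↔ ResampleLE μ₂ μ₁ f := by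
  unfold ResampleLE
  refine forall_congr' fun C => forall_congr' fun e => ?_
  simp_rw [mul_neg, sum_neg_distrib]
  exact neg_le_neg_iff

/-- **Main Lemma 8.1 under the REVERSED condition (18)** (`μ₂(X₂) ≤ μ₁(X₁)`, the situation of
Theorem 8.7): `condEx μ₂ D f C ≤ eval T D f C ≤ condEx μ₁ D f C`, i.e. `P(C₁ ∈ A) ≥ P(C ∈ A) ≥ P(C₂ ∈ A)`.
[cite: Gladkov2024, Main Lemma 8.1 (19) and Theorem 8.7 (24)] -/
theorem condEx_le_eval_of_rev (hf : ResampleLE μ₂ μ₁ f) (h₁ : ∀ i x, 0 ≤ μ₁ i x)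
    (h₂ : ∀ i x, 0 ≤ μ₂ i x) {T : GTree ι Ω} {D : Finset ι} (hT : T.ValidOn D) (C : ι → Ω) :
    condEx μ₂ D f C ≤ T.eval μ₁ μ₂ D f C ∧ T.eval μ₁ μ₂ D f C ≤ condEx μ₁ D f C := by
  have hf' : ResampleLE μ₁ μ₂ (fun C' => -f C') := resampleLE_neg_iff.2 hf
  have hlo := condEx_le_eval hf' h₁ h₂ T D C hT
  have hhi := eval_le_condEx hf' h₁ h₂ T D C hT
  rw [eval_neg, condEx_neg] at hlo hhi
  exact ⟨by linarith, by linarith⟩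

/-- Root form of `condEx_le_eval_of_rev`: `Ex μ₂ f ≤ P_T(f) ≤ Ex μ₁ f` for a tree valid on `univ`.
[cite: Gladkov2024, Main Lemma 8.1 (19) and Theorem 8.7 (24)] -/
theorem ex_le_eval_of_rev (hf : ResampleLE μ₂ μ₁ f) (h₁ : ∀ i x, 0 ≤ μ₁ i x)
    (h₂ : ∀ i x, 0 ≤ μ₂ i x) {T : GTree ι Ω} (hT : T.ValidOn univ) (C : ι → Ω) :
    Ex μ₂ f ≤ T.eval μ₁ μ₂ univ f C ∧ T.eval μ₁ μ₂ univ f C ≤ Ex μ₁ f := by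
  rw [← condEx_univ μ₂ f C, ← condEx_univ μ₁ f C]
  exact condEx_le_eval_of_rev hf h₁ h₂ hT C

end GTree

end Tree

/-! ### Theorem 8.7: the decision-tree Richards inequality, weighted -/
section Richards

namespace Richards

/-- The Bernoulli weight of one bit with parameter `q`: `q` for `true`, `1 - q` for `false`.
[cite: Gladkov2024, §2 (standing assumption: edge `e` open with probability `p_e`)] -/
def bw (q : ℝ) (b : Bool) : ℝ := if b then q else 1 - q

/-- Gladkov's `μ₁` of Theorem 8.7, weighted: "the mixture of the uniform distribution `μ₁₁` on
`{000, 111}` with the coefficient `2/3` and the uniform distribution `μ₁₂` on `Ω₁` with the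
coefficient `1/3`" — with `p`-coins in place of fair coins: with probability `2/3` the three bits of edge
`e` are ONE `p e`-coin, with probability `1/3` three independent `p e`-coins.
[cite: Gladkov2024, Theorem 8.7 (p. 16)] -/
def μ₁ (p : ι → ℝ) (e : ι) (x : Bool × Bool × Bool) : ℝ :=
  2 / 3 * (if x.1 = x.2.1 ∧ x.2.1 = x.2.2 then bw (p e) x.1 else 0)
    + 1 / 3 * (bw (p e) x.1 * bw (p e) x.2.1 * bw (p e) x.2.2)

/-- Gladkov's `μ₂` of Theorem 8.7, weighted: "the mixture of the uniform distribution `μ₂₁` on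
`{000, 011, 100, 111}` …, `μ₂₂` on `{000, 010, 101, 111}` …, and `μ₂₃` on `{000, 001, 110, 111}` with
the coefficient `1/3`" each — with probability `1/3` each, bit `i` is an independent `p e`-coin and the
other two bits are one common `p e`-coin. [cite: Gladkov2024, Theorem 8.7 (p. 16)] -/
def μ₂ (p : ι → ℝ) (e : ι) (x : Bool × Bool × Bool) : ℝ :=
  1 / 3 * (bw (p e) x.1 * if x.2.1 = x.2.2 then bw (p e) x.2.1 else 0)
    + 1 / 3 * (bw (p e) x.2.1 * if x.1 = x.2.2 then bw (p e) x.1 else 0)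
    + 1 / 3 * (bw (p e) x.2.2 * if x.1 = x.2.1 then bw (p e) x.1 else 0)

variable (p : ι → ℝ)

omit [Fintype ι] [DecidableEq ι] in
/-- `bw` is nonnegative on `[0, 1]`. [folklore] -/
theorem bw_nonneg {q : ℝ} (hq0 : 0 ≤ q) (hq1 : q ≤ 1) (b : Bool) : 0 ≤ bw q b := by
  unfold bw
  cases b
  · simp only [Bool.false_eq_true, if_false]; linarith
  · simp only [if_true]; exact hq0

omit [Fintype ι] [DecidableEq ι] in
/-- `μ₁ ≥ 0` for `p ∈ [0,1]`. [folklore] -/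
theorem μ₁_nonneg (hp0 : ∀ i, 0 ≤ p i) (hp1 : ∀ i, p i ≤ 1) (e : ι) (x : Bool × Bool × Bool) :
    0 ≤ μ₁ p e x := by
  have hb := fun b => bw_nonneg (hp0 e) (hp1 e) b
  unfold μ₁
  refine add_nonneg (mul_nonneg (by norm_num) ?_) (mul_nonneg (by norm_num)
    (mul_nonneg (mul_nonneg (hb _) (hb _)) (hb _)))
  split_ifs
  · exact hb _
  · exact le_rfl

omit [Fintype ι] [DecidableEq ι] in
/-- `μ₂ ≥ 0` for `p ∈ [0,1]`. [folklore] -/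
theorem μ₂_nonneg (hp0 : ∀ i, 0 ≤ p i) (hp1 : ∀ i, p i ≤ 1) (e : ι) (x : Bool × Bool × Bool) :
    0 ≤ μ₂ p e x := by
  have hb := fun b => bw_nonneg (hp0 e) (hp1 e) b
  have hi : ∀ (c : Prop) [Decidable c] (b : Bool), 0 ≤ (if c then bw (p e) b else 0) := by
    intro c _ b
    split_ifs
    · exact hb b
    · exact le_rfl
  unfold μ₂
  refine add_nonneg (add_nonneg ?_ ?_) ?_ <;>
    exact mul_nonneg (by norm_num) (mul_nonneg (hb _) (hi _ _))

omit [Fintype ι] [DecidableEq ι] in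
/-- `μ₁` has total mass one. [folklore] -/
theorem sum_μ₁ (e : ι) : ∑ x, μ₁ p e x = 1 := by
  simp only [Fintype.sum_prod_type, Fintype.sum_bool, μ₁, bw]
  norm_num
  ring

omit [Fintype ι] [DecidableEq ι] in
/-- `μ₂` has total mass one. [folklore] -/
theorem sum_μ₂ (e : ι) : ∑ x, μ₂ p e x = 1 := by
  simp only [Fintype.sum_prod_type, Fintype.sum_bool, μ₂, bw]
  norm_num
  ring

/-! #### Triple configurations and the product event `U × V × W` -/

/-- First bits of a triple configuration ("the configuration `E₁` formed by the first digits on the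
edges"). [cite: Gladkov2024, §8 (p. 16)] -/
def proj₁ (C : ι → Bool × Bool × Bool) : ι → Bool := fun i => (C i).1
/-- Second bits of a triple configuration. [cite: Gladkov2024, §8 (p. 16)] -/
def proj₂ (C : ι → Bool × Bool × Bool) : ι → Bool := fun i => (C i).2.1
/-- Third bits of a triple configuration. [cite: Gladkov2024, §8 (p. 16)] -/
def proj₃ (C : ι → Bool × Bool × Bool) : ι → Bool := fun i => (C i).2.2

/-- "An element `C` … belongs to `U×V×W` if the configuration `E₁` formed by the first digits on the
edges belongs to `U`, … `E₂` … belongs to `V` and … `E₃` … belongs to `W`."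
[cite: Gladkov2024, §8 (p. 16)] -/
def tripleEvent (U V W : Set (ι → Bool)) : Set (ι → Bool × Bool × Bool) :=
  {C | proj₁ C ∈ U ∧ proj₂ C ∈ V ∧ proj₃ C ∈ W}

omit [Fintype ι] in
/-- Updating a triple configuration updates its first bits. [folklore] -/
theorem proj₁_update (C : ι → Bool × Bool × Bool) (e : ι) (x : Bool × Bool × Bool) :
    proj₁ (update C e x) = update (proj₁ C) e x.1 := by
  funext i
  by_cases h : i = e
  · subst h; simp [proj₁]
  · simp [proj₁, h]

omit [Fintype ι] in
/-- Updating a triple configuration updates its second bits. [folklore] -/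
theorem proj₂_update (C : ι → Bool × Bool × Bool) (e : ι) (x : Bool × Bool × Bool) :
    proj₂ (update C e x) = update (proj₂ C) e x.2.1 := by
  funext i
  by_cases h : i = e
  · subst h; simp [proj₂]
  · simp [proj₂, h]

omit [Fintype ι] in
/-- Updating a triple configuration updates its third bits. [folklore] -/
theorem proj₃_update (C : ι → Bool × Bool × Bool) (e : ι) (x : Bool × Bool × Bool) :
    proj₃ (update C e x) = update (proj₃ C) e x.2.2 := by
  funext i
  by_cases h : i = e
  · subst h; simp [proj₃]
  · simp [proj₃, h]

/-! #### The five-case check of the printed proof, weighted -/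

/-- The one-edge weights of Theorem 8.7 without the edge index. [cite: Gladkov2024, Theorem 8.7] -/
def ν₁ (q : ℝ) (x : Bool × Bool × Bool) : ℝ :=
  2 / 3 * (if x.1 = x.2.1 ∧ x.2.1 = x.2.2 then bw q x.1 else 0)
    + 1 / 3 * (bw q x.1 * bw q x.2.1 * bw q x.2.2)

/-- The one-edge weights of Theorem 8.7 without the edge index. [cite: Gladkov2024, Theorem 8.7] -/
def ν₂ (q : ℝ) (x : Bool × Bool × Bool) : ℝ :=
  1 / 3 * (bw q x.1 * if x.2.1 = x.2.2 then bw q x.2.1 else 0)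
    + 1 / 3 * (bw q x.2.1 * if x.1 = x.2.2 then bw q x.1 else 0)
    + 1 / 3 * (bw q x.2.2 * if x.1 = x.2.1 then bw q x.1 else 0)

omit [Fintype ι] [DecidableEq ι] in
/-- `μ₁ p e = ν₁ (p e)`. [folklore] -/
theorem μ₁_eq (e : ι) (x : Bool × Bool × Bool) : μ₁ p e x = ν₁ (p e) x := rfl

omit [Fintype ι] [DecidableEq ι] in
/-- `μ₂ p e = ν₂ (p e)`. [folklore] -/
theorem μ₂_eq (e : ι) (x : Bool × Bool × Bool) : μ₂ p e x = ν₂ (p e) x := rfl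

omit [Fintype ι] [DecidableEq ι] in
/-- **The printed case check, weighted, INCREASING sections.**  For the section
`X = X¹ × X² × X³ ⊆ {0,1}³` of `U×V×W` at `(C, e)` — each `Xⁱ` an up-set of `{0,1}`, encoded by its
indicator `u, v, w : Bool → ℝ ∈ {(0,0), (0,1), (1,1)}` — one has `μ₂(X) ≤ μ₁(X)`.  With
`a = π_q(X¹)`, `b`, `c ∈ {0, q, 1}` this is `a·min(b,c) + b·min(a,c) + c·min(a,b) ≤ 2·min(a,b,c) + abc`,
i.e. `(1 - b)(2 - c) ≥ 0` after sorting; the printed five cases are `q = 1/2`.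
[cite: Gladkov2024, Theorem 8.7 (proof, p. 17)] -/
theorem caseCheck_inc (q : ℝ) (hq0 : 0 ≤ q) (hq1 : q ≤ 1) {u v w : Bool → ℝ}
    (hu : (u false = 0 ∧ u true = 0) ∨ (u false = 0 ∧ u true = 1) ∨ (u false = 1 ∧ u true = 1))
    (hv : (v false = 0 ∧ v true = 0) ∨ (v false = 0 ∧ v true = 1) ∨ (v false = 1 ∧ v true = 1))
    (hw : (w false = 0 ∧ w true = 0) ∨ (w false = 0 ∧ w true = 1) ∨ (w false = 1 ∧ w true = 1)) :
    ∑ x, ν₂ q x * (u x.1 * v x.2.1 * w x.2.2) ≤ ∑ x, ν₁ q x * (u x.1 * v x.2.1 * w x.2.2) := by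
  have h1q : 0 ≤ 1 - q := by linarith
  rcases hu with ⟨hu0, hu1⟩ | ⟨hu0, hu1⟩ | ⟨hu0, hu1⟩ <;>
  rcases hv with ⟨hv0, hv1⟩ | ⟨hv0, hv1⟩ | ⟨hv0, hv1⟩ <;>
  rcases hw with ⟨hw0, hw1⟩ | ⟨hw0, hw1⟩ | ⟨hw0, hw1⟩ <;>
  simp [Fintype.sum_prod_type, ν₁, ν₂, bw, hu0, hu1, hv0, hv1, hw0, hw1] <;>
  nlinarith [mul_nonneg hq0 h1q, mul_nonneg (mul_nonneg hq0 h1q) h1q, mul_nonneg (mul_nonneg hq0 h1q) hq0]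

omit [Fintype ι] [DecidableEq ι] in
/-- **The printed case check, weighted, DECREASING sections** (`u, v, w ∈ {(0,0), (1,0), (1,1)}`):
again `μ₂(X) ≤ μ₁(X)` (the bit-flip `q ↦ 1 - q` of `caseCheck_inc`).
[cite: Gladkov2024, Theorem 8.7 (proof, p. 17)] -/
theorem caseCheck_dec (q : ℝ) (hq0 : 0 ≤ q) (hq1 : q ≤ 1) {u v w : Bool → ℝ}
    (hu : (u false = 0 ∧ u true = 0) ∨ (u false = 1 ∧ u true = 0) ∨ (u false = 1 ∧ u true = 1))
    (hv : (v false = 0 ∧ v true = 0) ∨ (v false = 1 ∧ v true = 0) ∨ (v false = 1 ∧ v true = 1))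
    (hw : (w false = 0 ∧ w true = 0) ∨ (w false = 1 ∧ w true = 0) ∨ (w false = 1 ∧ w true = 1)) :
    ∑ x, ν₂ q x * (u x.1 * v x.2.1 * w x.2.2) ≤ ∑ x, ν₁ q x * (u x.1 * v x.2.1 * w x.2.2) := by
  have h1q : 0 ≤ 1 - q := by linarith
  rcases hu with ⟨hu0, hu1⟩ | ⟨hu0, hu1⟩ | ⟨hu0, hu1⟩ <;>
  rcases hv with ⟨hv0, hv1⟩ | ⟨hv0, hv1⟩ | ⟨hv0, hv1⟩ <;>
  rcases hw with ⟨hw0, hw1⟩ | ⟨hw0, hw1⟩ | ⟨hw0, hw1⟩ <;>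
  simp [Fintype.sum_prod_type, ν₁, ν₂, bw, hu0, hu1, hv0, hv1, hw0, hw1] <;>
  nlinarith [mul_nonneg hq0 h1q, mul_nonneg (mul_nonneg hq0 h1q) h1q, mul_nonneg (mul_nonneg hq0 h1q) hq0]

/-! #### Condition (18) for `U × V × W`, and Theorem 8.7 -/

variable {p}

omit [Fintype ι] in
/-- The indicator of `U×V×W` at an updated triple configuration factorises over the three bits.
[folklore] -/
theorem ind_tripleEvent_update (U V W : Set (ι → Bool)) (C : ι → Bool × Bool × Bool) (e : ι)
    (x : Bool × Bool × Bool) :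
    ind (tripleEvent U V W) (update C e x) =
      (if update (proj₁ C) e x.1 ∈ U then 1 else 0) * (if update (proj₂ C) e x.2.1 ∈ V then 1 else 0) *
        (if update (proj₃ C) e x.2.2 ∈ W then 1 else 0) := by
  have hmem : update C e x ∈ tripleEvent U V W ↔
      update (proj₁ C) e x.1 ∈ U ∧ update (proj₂ C) e x.2.1 ∈ V ∧ update (proj₃ C) e x.2.2 ∈ W := by
    simp only [tripleEvent, Set.mem_setOf_eq, proj₁_update, proj₂_update, proj₃_update]
  unfold ind
  by_cases h₁ : update (proj₁ C) e x.1 ∈ U <;> by_cases h₂ : update (proj₂ C) e x.2.1 ∈ V <;>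
    by_cases h₃ : update (proj₃ C) e x.2.2 ∈ W <;> simp [hmem, h₁, h₂, h₃]

omit [Fintype ι] in
/-- The section of an up-set along one bit is one of `∅ ⊆ {1} ⊆ {0,1}`, as an indicator pattern.
[folklore] -/
theorem pattern_inc {U : Set (ι → Bool)} (hU : IsUpperSet U) (g : ι → Bool) (e : ι) :
    ((if update g e false ∈ U then (1 : ℝ) else 0) = 0 ∧ (if update g e true ∈ U then (1 : ℝ) else 0) = 0) ∨
    ((if update g e false ∈ U then (1 : ℝ) else 0) = 0 ∧ (if update g e true ∈ U then (1 : ℝ) else 0) = 1) ∨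
    ((if update g e false ∈ U then (1 : ℝ) else 0) = 1 ∧ (if update g e true ∈ U then (1 : ℝ) else 0) = 1) := by
  have hle : update g e false ≤ update g e true :=
    update_le_update_iff.2 ⟨by decide, fun _ _ => le_rfl⟩
  by_cases h0 : update g e false ∈ U
  · have h1 : update g e true ∈ U := hU hle h0
    exact Or.inr (Or.inr ⟨by simp [h0], by simp [h1]⟩)
  · by_cases h1 : update g e true ∈ U
    · exact Or.inr (Or.inl ⟨by simp [h0], by simp [h1]⟩)
    · exact Or.inl ⟨by simp [h0], by simp [h1]⟩

omit [Fintype ι] in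
/-- The section of a down-set along one bit is one of `∅ ⊆ {0} ⊆ {0,1}`, as an indicator pattern.
[folklore] -/
theorem pattern_dec {U : Set (ι → Bool)} (hU : IsLowerSet U) (g : ι → Bool) (e : ι) :
    ((if update g e false ∈ U then (1 : ℝ) else 0) = 0 ∧ (if update g e true ∈ U then (1 : ℝ) else 0) = 0) ∨
    ((if update g e false ∈ U then (1 : ℝ) else 0) = 1 ∧ (if update g e true ∈ U then (1 : ℝ) else 0) = 0) ∨
    ((if update g e false ∈ U then (1 : ℝ) else 0) = 1 ∧ (if update g e true ∈ U then (1 : ℝ) else 0) = 1) := by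
  have hle : update g e false ≤ update g e true :=
    update_le_update_iff.2 ⟨by decide, fun _ _ => le_rfl⟩
  by_cases h1 : update g e true ∈ U
  · have h0 : update g e false ∈ U := hU hle h1
    exact Or.inr (Or.inr ⟨by simp [h0], by simp [h1]⟩)
  · by_cases h0 : update g e false ∈ U
    · exact Or.inr (Or.inl ⟨by simp [h0], by simp [h1]⟩)
    · exact Or.inl ⟨by simp [h0], by simp [h1]⟩

omit [Fintype ι] in
/-- **Condition (18) of Theorem 8.7, weighted, increasing events**: for up-sets `U, V, W` and
`p ∈ [0,1]^ι`, resampling one edge's triple from `μ₁` rather than `μ₂` does not decrease the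
probability of `U×V×W`: `ResampleLE (μ₂ p) (μ₁ p) 𝟙_{U×V×W}` ("we are left to check that
`μ₁(X) ≥ μ₂(X)`"). [cite: Gladkov2024, Theorem 8.7 (proof, p. 17)] -/
theorem resampleLE_inc (hp0 : ∀ i, 0 ≤ p i) (hp1 : ∀ i, p i ≤ 1) {U V W : Set (ι → Bool)}
    (hU : IsUpperSet U) (hV : IsUpperSet V) (hW : IsUpperSet W) :
    ResampleLE (μ₂ p) (μ₁ p) (ind (tripleEvent U V W)) := by
  intro C e
  simp_rw [ind_tripleEvent_update, μ₁_eq, μ₂_eq]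
  exact caseCheck_inc (p e) (hp0 e) (hp1 e)
    (u := fun b => if update (proj₁ C) e b ∈ U then 1 else 0)
    (v := fun b => if update (proj₂ C) e b ∈ V then 1 else 0)
    (w := fun b => if update (proj₃ C) e b ∈ W then 1 else 0)
    (pattern_inc hU (proj₁ C) e) (pattern_inc hV (proj₂ C) e) (pattern_inc hW (proj₃ C) e)

omit [Fintype ι] in
/-- **Condition (18) of Theorem 8.7, weighted, decreasing events** (down-sets `U, V, W`).
[cite: Gladkov2024, Theorem 8.7 (proof, p. 17)] -/
theorem resampleLE_dec (hp0 : ∀ i, 0 ≤ p i) (hp1 : ∀ i, p i ≤ 1) {U V W : Set (ι → Bool)}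
    (hU : IsLowerSet U) (hV : IsLowerSet V) (hW : IsLowerSet W) :
    ResampleLE (μ₂ p) (μ₁ p) (ind (tripleEvent U V W)) := by
  intro C e
  simp_rw [ind_tripleEvent_update, μ₁_eq, μ₂_eq]
  exact caseCheck_dec (p e) (hp0 e) (hp1 e)
    (u := fun b => if update (proj₁ C) e b ∈ U then 1 else 0)
    (v := fun b => if update (proj₂ C) e b ∈ V then 1 else 0)
    (w := fun b => if update (proj₃ C) e b ∈ W then 1 else 0)
    (pattern_dec hU (proj₁ C) e) (pattern_dec hV (proj₂ C) e) (pattern_dec hW (proj₃ C) e)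

/-- **Theorem 8.7 (decision-tree Richards inequality), weighted, increasing events.**  For up-sets
`U, V, W ⊆ {0,1}^ι`, edge probabilities `p ∈ [0,1]^ι` and every generating tree `T` valid on all edges
(decision `false` = draw the edge's triple from `μ₁ p`, `true` = from `μ₂ p`):
`P(C₂ ∈ U×V×W) ≤ P(C_T ∈ U×V×W) ≤ P(C₁ ∈ U×V×W)` — equation (24).
[cite: Gladkov2024, Theorem 8.7 (24)] -/
theorem thm87_inc (hp0 : ∀ i, 0 ≤ p i) (hp1 : ∀ i, p i ≤ 1) {U V W : Set (ι → Bool)}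
    (hU : IsUpperSet U) (hV : IsUpperSet V) (hW : IsUpperSet W) {T : GTree ι (Bool × Bool × Bool)}
    (hT : T.ValidOn univ) (C : ι → Bool × Bool × Bool) :
    Ex (μ₂ p) (ind (tripleEvent U V W)) ≤ T.eval (μ₁ p) (μ₂ p) univ (ind (tripleEvent U V W)) C ∧
      T.eval (μ₁ p) (μ₂ p) univ (ind (tripleEvent U V W)) C ≤ Ex (μ₁ p) (ind (tripleEvent U V W)) :=
  GTree.ex_le_eval_of_rev (resampleLE_inc hp0 hp1 hU hV hW) (μ₁_nonneg p hp0 hp1) (μ₂_nonneg p hp0 hp1)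
    hT C

/-- **Theorem 8.7 (decision-tree Richards inequality), weighted, decreasing events** (down-sets
`U, V, W`): `P(C₂ ∈ U×V×W) ≤ P(C_T ∈ U×V×W) ≤ P(C₁ ∈ U×V×W)`.
[cite: Gladkov2024, Theorem 8.7 (24)] -/
theorem thm87_dec (hp0 : ∀ i, 0 ≤ p i) (hp1 : ∀ i, p i ≤ 1) {U V W : Set (ι → Bool)}
    (hU : IsLowerSet U) (hV : IsLowerSet V) (hW : IsLowerSet W) {T : GTree ι (Bool × Bool × Bool)}
    (hT : T.ValidOn univ) (C : ι → Bool × Bool × Bool) :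
    Ex (μ₂ p) (ind (tripleEvent U V W)) ≤ T.eval (μ₁ p) (μ₂ p) univ (ind (tripleEvent U V W)) C ∧
      T.eval (μ₁ p) (μ₂ p) univ (ind (tripleEvent U V W)) C ≤ Ex (μ₁ p) (ind (tripleEvent U V W)) :=
  GTree.ex_le_eval_of_rev (resampleLE_dec hp0 hp1 hU hV hW) (μ₁_nonneg p hp0 hp1) (μ₂_nonneg p hp0 hp1)
    hT C

/-- **Theorem 8.7, tree-free corollary, increasing events**: `P(C₂ ∈ U×V×W) ≤ P(C₁ ∈ U×V×W)`, i.e.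
the `μ₂`-coupled triple is dominated by the `μ₁`-coupled triple on products of three up-sets — the
theorem-grade hybrid of Richards' conjectured inequality (25) (Remark 8.8).
[cite: Gladkov2024, Theorem 8.7 (24) and Remark 8.8] -/
theorem ex₂_le_ex₁_inc (hp0 : ∀ i, 0 ≤ p i) (hp1 : ∀ i, p i ≤ 1) {U V W : Set (ι → Bool)}
    (hU : IsUpperSet U) (hV : IsUpperSet V) (hW : IsUpperSet W) :
    Ex (μ₂ p) (ind (tripleEvent U V W)) ≤ Ex (μ₁ p) (ind (tripleEvent U V W)) :=
  ex_le_ex (resampleLE_inc hp0 hp1 hU hV hW) (μ₂_nonneg p hp0 hp1) (μ₁_nonneg p hp0 hp1)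

/-- **Theorem 8.7, tree-free corollary, decreasing events**: `P(C₂ ∈ U×V×W) ≤ P(C₁ ∈ U×V×W)` for
three down-sets. [cite: Gladkov2024, Theorem 8.7 (24) and Remark 8.8] -/
theorem ex₂_le_ex₁_dec (hp0 : ∀ i, 0 ≤ p i) (hp1 : ∀ i, p i ≤ 1) {U V W : Set (ι → Bool)}
    (hU : IsLowerSet U) (hV : IsLowerSet V) (hW : IsLowerSet W) :
    Ex (μ₂ p) (ind (tripleEvent U V W)) ≤ Ex (μ₁ p) (ind (tripleEvent U V W)) :=
  ex_le_ex (resampleLE_dec hp0 hp1 hU hV hW) (μ₂_nonneg p hp0 hp1) (μ₁_nonneg p hp0 hp1)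

end Richards

end Richards

end DecisionTree

end Literature.Probability.Percolation

end
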